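import Summits.HodgeConjecture.HodgeConjecture.Theorems.EightfoldBlochSeedsReachHyperbolicRiemannRealisable
import Summits.HodgeConjecture.HodgeConjecture.Theorems.EightfoldBlochSeedsDefs
import HarnessLib

/-!
# Route `EightfoldBlochSeeds`, crux `ReachHyperbolic` (item stmt-HodgeConjecture-18883), line `moduli-riemann`
# (`Cruxes/ReachHyperbolic/Lines/moduli_riemann.lean` 1ba65e5152037605): the registered stubs `stub_riemannRealisable` and
# `stub_rung_riemannSurfaces` BY NAME (vocabulary `Theorems.EightfoldBlochSeeds.RiemannRealisableAt` = the skeleton's, verbatim)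

HONEST FRAMING. Riemann's existence theorem at Weil type (the transcendental stub of the line) and its surface rung; the proof is
`Theorems.exists_realisedBy_of_isWeilComplexStructure` (`EightfoldBlochSeedsReachHyperbolicRiemannRealisable.lean`). Nothing here proves
`stub_moduliComplete`, the crux `ReachHyperbolic`, rung H2, HC_AV or HC. No definition, no named fact (D-0026).

[cite: DeligneMilne1982Tannakian, art. II §6 Thm. 6.20 (Riemann)] [cite: Shimura1998, §7.1 Prop. 7]
-/

noncomputable section

-- single-problem summit (Problem = Summit): the mandated namespace repeats `HodgeConjecture`.
set_option linter.dupNamespace false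

open CategoryTheory AlgebraicGeometry
open Literature.AlgebraicGeometry Literature.AlgebraicGeometry.Motives Literature.AlgebraicGeometry.HodgeTheory
open Summit.HodgeConjecture.HodgeConjecture.Theorems.EightfoldBlochSeeds

namespace Summit.HodgeConjecture.HodgeConjecture.Theorems

/-- **`stub_riemannRealisable`: RIEMANN'S EXISTENCE THEOREM AT WEIL TYPE `(n, n)`, every `n, d ≥ 1`** (the registered transcendental
stub of line `moduli-riemann`, by name and signature). [cite: DeligneMilne1982Tannakian, art. II §6 Thm. 6.20 (Riemann)]
[cite: Shimura1998, §7.1 Prop. 7] -/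
theorem stub_riemannRealisable : ∀ (n d : ℕ), 1 ≤ n → 1 ≤ d → RiemannRealisableAt n d :=
  fun _ _ _ _ _ _ e _ hP ha ha0 _ _ hm hPm hd' hψ _ hω hω0 J hW =>
    exists_realisedBy_of_isWeilComplexStructure e ha ha0 hm hPm hd' hψ hω hω0 hP J hW

/-- **`stub_rung_riemannSurfaces`: the surface rung `n = 1`** (by name and signature). [cite: DeligneMilne1982Tannakian, art. II §6 Thm. 6.20 (Riemann)]
[cite: Shimura1963AnalyticFamilies, §4] -/
theorem stub_rung_riemannSurfaces : ∀ (d : ℕ), 1 ≤ d → RiemannRealisableAt 1 d :=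
  fun d hd => stub_riemannRealisable 1 d le_rfl hd

end Summit.HodgeConjecture.HodgeConjecture.Theorems

end
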